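import Summits.HodgeConjecture.CorCM.SimpleCMDistinctClosuresPairwise
import Summits.HodgeConjecture.CorCM.IrreducibleOddWeightsHodgeGluingBlocks
import Summits.HodgeConjecture.CorCM.DistinctPrimeDimensionsCMHodge
import HarnessLib

/-!
# MULTI-FIELD WEIL ENGINE — THE THREEFOLD BLOCK SPLITS OFF THE SURFACE BLOCK: for ANY finite family of simple CM abelian varieties of dimension `≤ 3`,
# `Hg(everything) = Hg(threefolds ∪ the curves through their fields) × Hg(surfaces ∪ the other curves)` — UNCONDITIONALLY

Cell `pub-hodgecm2` (COR-CM), seat b30 gen 35 (2026-08-25); count-neutral own lane MULTI-FIELD WEIL ENGINE (stem `MultiFieldWeil*`).  Theorems only; no definition,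
no named fact, no `sorry`.  HONEST FRAMING: everything in this file is UNCONDITIONAL — a structure theorem on Mumford–Tate groups of CM abelian varieties (§1) and a
TRANSFER of instances of the Hodge conjecture (§2); `HC_CM` is NOT proved and not asserted.

THE POINT.  Gens 31–34 of this lane settled every product of copies of «at most TWO simple CM abelian varieties of dimension `≤ 3` and any CM elliptic curves» modulo
Markman's fourfold theorem, and seat b16's obstruction (iii′) shows that THREE simple CM surfaces can fail (the dihedral triple).  This file separates the two worlds once
and for all.  Let `A_i ⊨ (K_i; Φ_i)` (`i ∈ I`, finite) be SIMPLE complex abelian varieties of CM type of dimension `≤ 3` — any number of threefolds, of surfaces, of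
curves, isogenous or not, nothing assumed on the fields.  MARK a slot `i` when its field embeds in a SEXTIC member field: `p i :⟺ ∃ t, [K_t : ℚ] = 6 ∧ K_i ↪ K_t`.
The marked slots are exactly the threefolds and the CM elliptic curves whose imaginary quadratic fields lie in some threefold's field (the curves the threefolds
ABSORB, gen 34); the unmarked ones are the simple surfaces (a quartic field embeds in no sextic one) and the remaining curves.  THEN (§1,
**`cmFamilyRank_add_two_eq_threefoldBlock_surfaceBlock`**)

  `rank(Σ) + 2 = rank(Σ|_{p}) + rank(Σ|_{¬p}) + 1`, i.e. `Hg(∏_i A_i) = Hg(∏_{p i} A_i) × Hg(∏_{¬p j} A_j)`,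

with NOTHING asked inside either block (both may be as degenerate as they like: two threefolds through one imaginary quadratic field, the dihedral surface triple, …).
PROOF: seat p2's rank additivity over a partition from the slot criterion ACROSS the blocks (`CMAlgebra.cmFamilyRank_add_card_eq_of_pairwise_slots_fiber`); the four kinds
of cross pairs are all in the tree BY NAME — threefold ∕ simple surface: seat b16's PAIR KIT `pairwise_simple_dim_le_three_of_normalClosure_ne` (the Galois closures differ,
`6 ∣ [L_T : ℚ]` against `[L_S : ℚ] ∈ {4, 8}`, and a quartic CM field with a primitive type neither contains nor receives an imaginary quadratic field); threefold ∕ unmarked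
curve, marked curve ∕ surface, marked curve ∕ unmarked curve: foreign quadratic slots, b16's `pairwise_of_isEmpty` (an unmarked curve's field embeds in no threefold field,
hence in no marked curve's field either; no imaginary quadratic field embeds in a simple surface's field).  §2 (**`hodgeConjectureFor_prod_of_threefoldBlock_surfaceBlock`**)
is the transfer by b16's block gluing `hodgeConjectureFor_biproduct_of_cmFamilyRank_fiber_add_card_eq`: the Hodge conjecture for every product of copies of the marked members
among themselves AND for every product of copies of the unmarked members among themselves gives it for EVERY product of copies `⨁_j A_{π j}` of the whole family.  The
sequel `CorCM/MultiFieldWeilAtMostTwoThreefoldsTwoSurfacesAnyCurves.lean` feeds the two blocks with this lane's roofs.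

[cite: MoonenZarhin1999LowDim, Thm. (0.2), §3 (3.1), Cor. (3.9)] [cite: Gordon1999HodgeAVSurvey, §3 Theorem (proof), 7.4–7.7] [cite: Shimura1998, §8.2 Prop. 26, §8.4 (2)]
[cite: Dodson1984, §1 and §5.1.2] [cite: MumfordAV1970, §19 Thm. 1 and p. 169]

## References
* [MoonenZarhin1999LowDim] B. Moonen, Yu. Zarhin, *Hodge classes on abelian varieties of low dimension*, Math. Ann. 315 (1999) 711–733.  [Gordon1999HodgeAVSurvey] B. B.
  Gordon, *A survey of the Hodge conjecture for abelian varieties*, §3, 7.4–7.7.  [Shimura1998] G. Shimura, *Abelian varieties with complex multiplication and modular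
  functions*, §8.2, §8.4.  [Dodson1984] B. Dodson, *The structure of Galois groups of CM-fields*, Trans. AMS 283 (1984).  [MumfordAV1970] D. Mumford, *Abelian Varieties*, §19.
-/

noncomputable section

open CategoryTheory CategoryTheory.Limits NumberField IntermediateField

namespace Summit.HodgeConjecture.CorCM.MultiFieldWeil

open Literature.AlgebraicGeometry Literature.AlgebraicGeometry.Motives Literature.AlgebraicGeometry.HodgeTheory
open Literature.AlgebraicGeometry.ComplexMultiplication (IsCMTypeRealisation isSimple_iff_isPrimitive)
open Literature.AlgebraicTopology.SingularHomology
open Literature.NumberTheory.ComplexMultiplication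
open Literature.AlgebraicGeometry.Pohlmann1968

open scoped Classical

variable {I : Type} {K : I → Type} [∀ i, Field (K i)] [∀ i, NumberField (K i)] [∀ i, IsCMField (K i)]
  {Φ : ∀ i, CMType (K i)} {A : I → AbelianVariety ℂ} {ι : ∀ i, 𝓞 (K i) →+* End (A i)} {θ : ∀ i, K i →+* Module.End ℂ (complexBetti (A i).X 1)}

/-! ## §0 Degrees -/

section Degrees

omit [∀ i, IsCMField (K i)] in
/-- The CM field of a realisation of dimension `≤ 3` has degree `2`, `4` or `6`. [cite: Shimura1998, §5.2] -/
private theorem finrank_eq_or_of_dim_le_three₃₅ (hA : ∀ i, IsCMTypeRealisation (Φ i) (A i) (ι i) (θ i)) {i : I} (h3 : (A i).dim ≤ 3) :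
    Module.finrank ℚ (K i) = 2 ∨ Module.finrank ℚ (K i) = 4 ∨ Module.finrank ℚ (K i) = 6 := by
  have h := finrank_eq_two_mul_dim_of_isCMTypeRealisation (hA i)
  have hpos : 0 < Module.finrank ℚ (K i) := Module.finrank_pos
  interval_cases hd : (A i).dim <;> omega

omit [∀ i, IsCMField (K i)] in
/-- An embedding of number fields `K_i ↪ K_t` makes `[K_i : ℚ]` divide `[K_t : ℚ]` (the image is an intermediate field of the same degree; tower law).
[cite: Shimura1998, §8.1] -/
private theorem finrank_dvd_of_ringHom₃₅ {i t : I} (g : K i →+* K t) : Module.finrank ℚ (K i) ∣ Module.finrank ℚ (K t) := by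
  have h1 : Module.finrank ℚ ↥g.toRatAlgHom.fieldRange = Module.finrank ℚ (K i) :=
    ((AlgEquiv.ofInjectiveField g.toRatAlgHom).toLinearEquiv.finrank_eq).symm
  rw [← h1, ← IntermediateField.finrank_top' (F := ℚ) (E := K t)]
  exact IntermediateField.finrank_dvd_of_le_right le_top

/-- **A simple CM abelian surface's field receives no imaginary quadratic field** (its type is primitive, so complex conjugation on `Hom(K_j, ℂ)` is a square in `Aut(ℂ)`,
seat b16's (□)). [cite: Shimura1998, §8.2 Prop. 26, §8.4 (2)] -/
theorem not_exists_quadratic_ringHom_of_simpleSurface (hA : ∀ i, IsCMTypeRealisation (Φ i) (A i) (ι i) (θ i)) {j : I} (h4 : Module.finrank ℚ (K j) = 4)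
    (hS : (A j).IsSimple) (i : I) : ¬ ∃ F : IntermediateField ℚ (K i), Module.finrank ℚ F = 2 ∧ IsTotallyComplex F ∧ Nonempty (F →+* K j) := by
  rintro ⟨F, hF2, hFtc, ⟨g⟩⟩
  haveI := hFtc
  obtain ⟨φ₀⟩ : Nonempty (K j →+* ℂ) := inferInstance
  exact (isEmpty_ringHom_of_smul_smul_of_isTotallyComplex (k := ↥F) (L := K j) hF2
    (QuarticCM.exists_ringAut_smul_smul_eq_conjugate_of_isPrimitive h4 ((isSimple_iff_isPrimitive (hA j) φ₀).1 hS))).false g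

/-- **A simple CM abelian surface's field contains no imaginary quadratic field** (same reason, applied to the inclusion). [cite: Shimura1998, §8.2 Prop. 26, §8.4 (2)] -/
theorem not_exists_quadratic_subfield_of_simpleSurface (hA : ∀ i, IsCMTypeRealisation (Φ i) (A i) (ι i) (θ i)) {j : I} (h4 : Module.finrank ℚ (K j) = 4)
    (hS : (A j).IsSimple) (i : I) : ¬ ∃ F : IntermediateField ℚ (K j), Module.finrank ℚ F = 2 ∧ IsTotallyComplex F ∧ Nonempty (F →+* K i) := by
  rintro ⟨F, hF2, hFtc, -⟩
  exact not_exists_quadratic_ringHom_of_simpleSurface hA h4 hS j ⟨F, hF2, hFtc, ⟨algebraMap (↥F) (K j)⟩⟩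

/-- **A CM elliptic curve's field does not embed in a simple CM abelian surface's field.** [cite: Shimura1998, §8.2 Prop. 26, §8.4 (2)] -/
theorem isEmpty_ringHom_curve_simpleSurface (hA : ∀ i, IsCMTypeRealisation (Φ i) (A i) (ι i) (θ i)) {a j : I} (h2 : Module.finrank ℚ (K a) = 2)
    (h4 : Module.finrank ℚ (K j) = 4) (hS : (A j).IsSimple) : IsEmpty (K a →+* K j) := by
  refine ⟨fun g => not_exists_quadratic_ringHom_of_simpleSurface hA h4 hS a ⟨⊤, by rw [IntermediateField.finrank_top', h2], ?_, ?_⟩⟩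
  · letI : Algebra (K a) ↥(⊤ : IntermediateField ℚ (K a)) := (IntermediateField.topEquiv (F := ℚ) (E := K a)).symm.toRingEquiv.toRingHom.toAlgebra
    exact isTotallyComplex_of_algebra (K a) _
  · exact ⟨g.comp (⊤ : IntermediateField ℚ (K a)).val.toRingHom⟩

end Degrees

/-! ## §1 The threefold block splits off the surface block (Mumford–Tate ranks) -/

section Rank

/-- **THE CROSS-BLOCK SLOT CRITERION.**  `A_i ⊨ (K_i; Φ_i)` simple of dimension `≤ 3` (all `i`); `K_i` embeds in some sextic member field `K_t` and `K_j` embeds in none.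
Then the `Aut(ℂ)`-modules `U(Φ_i)`, `U(Φ_j)` have no common constituent, in both orders.  Kinds: `i` a threefold (`t = i`) against `j` a simple surface — b16's pair kit
(closures differ by degree; no imaginary quadratic field inside or into a simple surface's field) — or against `j` a curve foreign to `K_i`; `i` a curve through `K_t`
against `j` a surface (`K_i ↪̸ K_j`) or a curve (`K_j ↪̸ K_i`, else `K_j ↪ K_t`); a quartic `K_i` cannot embed in the sextic `K_t`.
[cite: MoonenZarhin1999LowDim, Thm. (0.2), (3.1), Cor. (3.9)] [cite: Gordon1999HodgeAVSurvey, §3 Theorem (proof), 7.5] [cite: Shimura1998, §8.4 (2)] -/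
theorem pairwise_threefoldBlock_surfaceBlock (hA : ∀ i, IsCMTypeRealisation (Φ i) (A i) (ι i) (θ i)) (hS : ∀ i, (A i).IsSimple) (h3 : ∀ i, (A i).dim ≤ 3)
    {i j : I} (hi : ∃ t, Module.finrank ℚ (K t) = 6 ∧ Nonempty (K i →+* K t)) (hj : ¬ ∃ t, Module.finrank ℚ (K t) = 6 ∧ Nonempty (K j →+* K t)) :
    (∀ P : Submodule ℚ ((K i →+* ℂ) → ℚ), P ≤ antiSpan (ℂ ≃+* ℂ) (Φ i).1 →
      (∀ g : ℂ ≃+* ℂ, ∀ f ∈ P, (fun x => f (g • x)) ∈ P) →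
      ∀ T : ((K i →+* ℂ) → ℚ) →ₗ[ℚ] ((K j →+* ℂ) → ℚ),
        (∀ g : ℂ ≃+* ℂ, ∀ f ∈ P, T (fun x => f (g • x)) = fun y => T f (g • y)) →
        (∀ f ∈ P, T f ∈ antiSpan (ℂ ≃+* ℂ) (Φ j).1) → (∀ f ∈ P, T f = 0 → f = 0) → P = ⊥) ∧
    (∀ P : Submodule ℚ ((K j →+* ℂ) → ℚ), P ≤ antiSpan (ℂ ≃+* ℂ) (Φ j).1 →
      (∀ g : ℂ ≃+* ℂ, ∀ f ∈ P, (fun x => f (g • x)) ∈ P) →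
      ∀ T : ((K j →+* ℂ) → ℚ) →ₗ[ℚ] ((K i →+* ℂ) → ℚ),
        (∀ g : ℂ ≃+* ℂ, ∀ f ∈ P, T (fun x => f (g • x)) = fun y => T f (g • y)) →
        (∀ f ∈ P, T f ∈ antiSpan (ℂ ≃+* ℂ) (Φ i).1) → (∀ f ∈ P, T f = 0 → f = 0) → P = ⊥) := by
  obtain ⟨t, ht6, ⟨e⟩⟩ := hi
  have hj6 : Module.finrank ℚ (K j) ≠ 6 := fun h => hj ⟨j, h, ⟨RingHom.id _⟩⟩
  have hjt : ∀ t', Module.finrank ℚ (K t') = 6 → IsEmpty (K j →+* K t') := fun t' h => ⟨fun g => hj ⟨t', h, ⟨g⟩⟩⟩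
  rcases finrank_eq_or_of_dim_le_three₃₅ hA (h3 i) with hi2 | hi4 | hi6
  · -- `i` is a curve through `K_t`
    rcases finrank_eq_or_of_dim_le_three₃₅ hA (h3 j) with hj2 | hj4 | hj6'
    · -- `j` a curve: `K_j ↪̸ K_i` (else `K_j ↪ K_t`)
      have h := pairwise_of_isEmpty Φ hj2 (⟨fun g => (hjt t ht6).false (e.comp g)⟩ : IsEmpty (K j →+* K i))
      exact ⟨h.2, h.1⟩
    · -- `j` a simple surface: `K_i ↪̸ K_j`
      exact pairwise_of_isEmpty Φ hi2 (isEmpty_ringHom_curve_simpleSurface hA hi2 hj4 (hS j))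
    · exact absurd hj6' hj6
  · -- a quartic field does not embed in a sextic one
    exfalso
    have h := finrank_dvd_of_ringHom₃₅ e
    rw [hi4, ht6] at h
    omega
  · -- `i` is a threefold
    rcases finrank_eq_or_of_dim_le_three₃₅ hA (h3 j) with hj2 | hj4 | hj6'
    · -- `j` a curve foreign to `K_i`
      have h := pairwise_of_isEmpty Φ hj2 (hjt i hi6)
      exact ⟨h.2, h.1⟩
    · -- `j` a simple surface: b16's pair kit
      exact pairwise_simple_dim_le_three_of_normalClosure_ne hA hS h3 (fun h => not_normalClosure_le_of_sextic_of_quartic (K := K) hj4 hi6 h.le)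
        (not_exists_quadratic_ringHom_of_simpleSurface hA hj4 (hS j) i) (not_exists_quadratic_subfield_of_simpleSurface hA hj4 (hS j) i)
    · exact absurd hj6' hj6

variable [Fintype I]

/-- **THE THREEFOLD BLOCK SPLITS OFF THE SURFACE BLOCK (ranks).**  `A_i ⊨ (K_i; Φ_i)` (`i ∈ I` finite) SIMPLE complex abelian varieties of CM type of dimension `≤ 3`
— any number, isogenous or not, nothing on the fields; `p` marks the slots whose field embeds in a sextic member field (the threefolds and the curves through their fields);
both kinds occur.  Then `rank(Σ) + 2 = rank(Σ|_{p}) + rank(Σ|_{¬p}) + 1`: `Hg(∏_i A_i) = Hg(∏_{p i} A_i) × Hg(∏_{¬p j} A_j)` — UNCONDITIONALLY, and with nothing asked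
inside either block. [cite: MoonenZarhin1999LowDim, Thm. (0.2), §3 (3.1), Cor. (3.9)] [cite: Gordon1999HodgeAVSurvey, §3 Theorem (proof), 7.5] -/
theorem cmFamilyRank_add_two_eq_threefoldBlock_surfaceBlock (hA : ∀ i, IsCMTypeRealisation (Φ i) (A i) (ι i) (θ i)) (hS : ∀ i, (A i).IsSimple)
    (h3 : ∀ i, (A i).dim ≤ 3) (p : I → Prop) (hp : ∀ i, p i ↔ ∃ t, Module.finrank ℚ (K t) = 6 ∧ Nonempty (K i →+* K t)) (hpT : ∃ i, p i) (hpS : ∃ j, ¬ p j) :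
    CMAlgebra.cmFamilyRank Φ + Fintype.card Bool = (∑ c : Bool, CMAlgebra.cmFamilyRank fun i : {i : I // decide (p i) = c} => Φ i.1) + 1 := by
  obtain ⟨i₀, hi₀⟩ := hpT
  haveI : Nonempty I := ⟨i₀⟩
  refine CMAlgebra.cmFamilyRank_add_card_eq_of_pairwise_slots_fiber Φ (fun i => decide (p i)) (fun c => ?_) (fun i j hij => ?_)
  · cases c
    · obtain ⟨j, hj⟩ := hpS
      exact ⟨j, decide_eq_false hj⟩
    · exact ⟨i₀, decide_eq_true hi₀⟩
  · by_cases hi : p i <;> by_cases hj : p j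
    · exact absurd ((decide_eq_true hi).trans (decide_eq_true hj).symm) hij
    · exact (pairwise_threefoldBlock_surfaceBlock hA hS h3 ((hp i).1 hi) (fun h => hj ((hp j).2 h))).1
    · exact (pairwise_threefoldBlock_surfaceBlock hA hS h3 ((hp j).1 hj) (fun h => hi ((hp i).2 h))).2
    · exact absurd ((decide_eq_false hi).trans (decide_eq_false hj).symm) hij

/-- **Nondegeneracy is decided on the two blocks**: the whole family is (stably) nondegenerate iff the threefold block and the surface block both are.
[cite: MoonenZarhin1999LowDim, §3 (3.1)] [cite: Gordon1999HodgeAVSurvey, 7.5] -/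
theorem isNondegenerateFamily_iff_threefoldBlock_surfaceBlock (hA : ∀ i, IsCMTypeRealisation (Φ i) (A i) (ι i) (θ i)) (hS : ∀ i, (A i).IsSimple)
    (h3 : ∀ i, (A i).dim ≤ 3) (p : I → Prop) (hp : ∀ i, p i ↔ ∃ t, Module.finrank ℚ (K t) = 6 ∧ Nonempty (K i →+* K t)) (hpT : ∃ i, p i) (hpS : ∃ j, ¬ p j) :
    CMAlgebra.IsNondegenerateFamily Φ ↔ ∀ c : Bool, CMAlgebra.IsNondegenerateFamily fun i : {i : I // decide (p i) = c} => Φ i.1 := by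
  obtain ⟨i₀, hi₀⟩ := hpT
  haveI : Nonempty I := ⟨i₀⟩
  refine CMAlgebra.isNondegenerateFamily_iff_forall_fiber_of_pairwise_slots Φ (fun i => decide (p i)) (fun c => ?_) (fun i j hij => ?_)
  · cases c
    · obtain ⟨j, hj⟩ := hpS
      exact ⟨j, decide_eq_false hj⟩
    · exact ⟨i₀, decide_eq_true hi₀⟩
  · by_cases hi : p i <;> by_cases hj : p j
    · exact absurd ((decide_eq_true hi).trans (decide_eq_true hj).symm) hij
    · exact (pairwise_threefoldBlock_surfaceBlock hA hS h3 ((hp i).1 hi) (fun h => hj ((hp j).2 h))).1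
    · exact (pairwise_threefoldBlock_surfaceBlock hA hS h3 ((hp j).1 hj) (fun h => hi ((hp i).2 h))).2
    · exact absurd ((decide_eq_false hi).trans (decide_eq_false hj).symm) hij

end Rank

/-! ## §2 The Hodge conjecture glues the two blocks -/

section Glue

variable [Fintype I]

/-- **THE THREEFOLD BLOCK AND THE SURFACE BLOCK GLUE (Hodge conjecture).**  `A_i ⊨ (K_i; Φ_i)` (`i ∈ I` finite) SIMPLE, of CM type, of dimension `≤ 3`; `p` marks the
slots whose field embeds in a sextic member field; both kinds occur.  IF the Hodge conjecture holds for every product of copies of the marked members among themselves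
(the threefolds with the curves through their fields) AND for every product of copies of the unmarked members among themselves (the surfaces with the other curves), THEN
it holds for EVERY product of copies `⨁_j A_{π j}` of the whole family — UNCONDITIONALLY (§1 and seat b16's block gluing).
[cite: MoonenZarhin1999LowDim, Thm. (0.2), §3 (3.1), Cor. (3.9)] [cite: Gordon1999HodgeAVSurvey, §3 Theorem (proof), 7.5–7.7] -/
theorem hodgeConjectureFor_prod_of_threefoldBlock_surfaceBlock (hA : ∀ i, IsCMTypeRealisation (Φ i) (A i) (ι i) (θ i)) (hS : ∀ i, (A i).IsSimple)
    (h3 : ∀ i, (A i).dim ≤ 3) (p : I → Prop) (hp : ∀ i, p i ↔ ∃ t, Module.finrank ℚ (K t) = 6 ∧ Nonempty (K i →+* K t)) (hpT : ∃ i, p i) (hpS : ∃ j, ¬ p j)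
    (hT : ∀ (M : ℕ) (ρ : Fin M → I), (∀ l, p (ρ l)) → HodgeConjectureFor (⨁ fun l => A (ρ l)).dim (⨁ fun l => A (ρ l)).X)
    (hSf : ∀ (M : ℕ) (ρ : Fin M → I), (∀ l, ¬ p (ρ l)) → HodgeConjectureFor (⨁ fun l => A (ρ l)).dim (⨁ fun l => A (ρ l)).X)
    {N : ℕ} (π : Fin N → I) : HodgeConjectureFor (⨁ fun j => A (π j)).dim (⨁ fun j => A (π j)).X := by
  cases N with
  | zero => exact hSf 0 π fun l => l.elim0
  | succ N =>
    refine hodgeConjectureFor_biproduct_of_cmFamilyRank_fiber_add_card_eq (fun i => decide (p i)) (fun c => ?_)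
      (cmFamilyRank_add_two_eq_threefoldBlock_surfaceBlock hA hS h3 p hp hpT hpS) hA (fun c J _ _ π' => ?_) π
    · cases c
      · obtain ⟨j, hj⟩ := hpS
        exact ⟨j, decide_eq_false hj⟩
      · obtain ⟨i, hi⟩ := hpT
        exact ⟨i, decide_eq_true hi⟩
    · -- re-index the `J`-indexed product of members of the block `c` by `Fin |J|`
      let ε : Fin (Fintype.card J) ≃ J := (Fintype.equivFin J).symm
      have hdom : Domination.AVDominatedBy (⨁ fun j => A (π' j).1) (⨁ fun l => A (π' (ε l)).1) :=
        Domination.AVDominatedBy.of_iso (biproduct.reindex ε fun j => A (π' j).1).symm (Domination.AVDominatedBy.refl _)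
      refine Domination.hodgeConjectureFor_of_avDominatedBy ?_ hdom
      cases c
      · exact hSf _ (fun l => (π' (ε l)).1) fun l => of_decide_eq_false (π' (ε l)).2
      · exact hT _ (fun l => (π' (ε l)).1) fun l => of_decide_eq_true (π' (ε l)).2

/-- **Dominated form** of `hodgeConjectureFor_prod_of_threefoldBlock_surfaceBlock`. [cite: MoonenZarhin1999LowDim, §3 (3.1)] [cite: MumfordAV1970, §19 Thm. 1 and p. 169] -/
theorem hodgeConjectureFor_of_avDominatedBy_prod_of_threefoldBlock_surfaceBlock (hA : ∀ i, IsCMTypeRealisation (Φ i) (A i) (ι i) (θ i))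
    (hS : ∀ i, (A i).IsSimple) (h3 : ∀ i, (A i).dim ≤ 3) (p : I → Prop) (hp : ∀ i, p i ↔ ∃ t, Module.finrank ℚ (K t) = 6 ∧ Nonempty (K i →+* K t))
    (hpT : ∃ i, p i) (hpS : ∃ j, ¬ p j)
    (hT : ∀ (M : ℕ) (ρ : Fin M → I), (∀ l, p (ρ l)) → HodgeConjectureFor (⨁ fun l => A (ρ l)).dim (⨁ fun l => A (ρ l)).X)
    (hSf : ∀ (M : ℕ) (ρ : Fin M → I), (∀ l, ¬ p (ρ l)) → HodgeConjectureFor (⨁ fun l => A (ρ l)).dim (⨁ fun l => A (ρ l)).X)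
    {N : ℕ} (π : Fin N → I) {X : AbelianVariety ℂ} (hX : Domination.AVDominatedBy X (⨁ fun j => A (π j))) : HodgeConjectureFor X.dim X.X :=
  Domination.hodgeConjectureFor_of_avDominatedBy (hodgeConjectureFor_prod_of_threefoldBlock_surfaceBlock hA hS h3 p hp hpT hpS hT hSf π) hX

end Glue

end Summit.HodgeConjecture.CorCM.MultiFieldWeil

end
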